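import Summits.BirchSwinnertonDyer.BirchSwinnertonDyer.Theorems.TwinTransportX9ParityLaw

/-!
# Route `TwinTransportX9` — crux `TrivialTwinSupplyX9` (item 24080): typed KILL CRITERIA (refuter targets)

By the parity law (`trivialTwinSupplyX9_parityCases`, Modularity `hmod`), an ODD X9 pair can only be served by a
ONE-step unit twin and an EVEN pair only by a TWO-step one. Contrapositives, typed so that a refuter has an exact target:

* `not_trivialTwinSupplyX9_of_oddPair` — ONE X9 pair `(W, p)` with `p ∤ ∏ c_ℓ(W)` and `r_an(W)` odd at which EVERY
  admissible frame's minimal twin `W₁` of analytic rank `0` with `p ∤ #Ш(W₁)` has NON-unit `L(W₁,1)/Ω(W₁)` (every rational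
  value `q` has `v_p(q) ≠ 0`) refutes the crux.
* `not_trivialTwinSupplyX9_of_evenPair` — the same with two admissible steps at an even pair.

Since admissible analytic-rank-`0` twins EXIST class-wide (`TwinTransportX9AnalyticSupply`, Friedberg–Hoffstein), a kill
must come from the VALUES (a congruence forcing `v_p(L^alg) > 0` on the whole admissible progression) or from `Ш`, never
from ranks. Helper theorems (`--supports` item 24080); 0 sorry; BSD is NOT proved; the crux is neither proved nor refuted here.
References: [Darmon2004] §3.6; [BurungaleCastellaSkinner2025] §1.2; [Vatsal1999] (congruences of twisted special values).
-/

set_option linter.dupNamespace false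
set_option autoImplicit false

noncomputable section

open scoped Classical

open WeierstrassCurve Literature.NumberTheory.EllipticCurves
  Literature.NumberTheory.EllipticCurves.ModularForms
  Summit.BirchSwinnertonDyer.BirchSwinnertonDyer.Rank1Residual
  Summit.BirchSwinnertonDyer.BirchSwinnertonDyer.Theses.TwinTransportX9

namespace Summit.BirchSwinnertonDyer.BirchSwinnertonDyer.Theorems.TwinTransportX9Rung

/-- **Kill criterion at an odd pair.** Under Modularity: if at some X9 pair `(W, p)` with `p ∤ ∏ c_ℓ(W)` and odd
`r_an(W)` every BCS-admissible frame `(d_K, d_F)` and every globally minimal `W₁` with `C • W₁ = W^{(d_K)}`,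
`r_an(W₁) = 0`, `p ∤ #Ш(W₁)` has `v_p(q) ≠ 0` for every rational `q` with `L^*(W₁,1)/Ω(W₁) = q`, then
`TrivialTwinSupplyX9` is FALSE (the two-step escape is closed by `analyticRank_twin₂_ne_zero_of_odd`).
A typed refuter target; nothing is refuted here. [cite: Darmon2004, §3.6 Thm. 3.15 and p. 39]
[cite: BurungaleCastellaSkinner2025, §1.2, Prop. 5.2.1] -/
theorem not_trivialTwinSupplyX9_of_oddPair (hmod : exists_isNewformOf)
    (W : WeierstrassCurve ℚ) [W.IsElliptic] [W.IsGloballyMinimal] (p : ℕ) [Fact p.Prime]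
    (hX9 : ClassX9 W p) (hTam : ¬ p ∣ W.tamagawaProduct) (hodd : Odd W.analyticRank)
    (hno : ∀ dK dF : ℤ, BCSAdmissiblePair W p dK dF →
      ∀ (W₁ : WeierstrassCurve ℚ) (_ : W₁.IsElliptic) (_ : W₁.IsGloballyMinimal)
        (C : WeierstrassCurve.VariableChange ℚ), C • W₁ = W.quadraticTwist (dK : ℚ) →
        W₁.analyticRank = 0 → ¬ p ∣ W₁.shaOrder →
        ∀ q : ℚ, W₁.leadingLCoeff / (W₁.realPeriodRat : ℂ) = (q : ℂ) → padicValRat p q ≠ 0) :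
    ¬ TrivialTwinSupplyX9 := by
  intro h
  obtain ⟨dK, dF, hadm, W₁, i₁, i₁', ⟨C, hC⟩, hr, hsha, -, -, q, hq, hv⟩ :=
    (trivialTwinSupplyX9_parityCases hmod h W p hX9 hTam).1 hodd
  exact hno dK dF hadm W₁ i₁ i₁' C hC hr hsha q hq hv

/-- **Kill criterion at an even pair.** Under Modularity: if at some X9 pair `(W, p)` with `p ∤ ∏ c_ℓ(W)` and even
`r_an(W)` every two admissible steps `W ↦ W₁ ↦ W₂` (frames `(d_K, d_F)` for `(W, p)`, `(d_K', d_F')` for `(W₁, p)`,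
globally minimal models) ending at `r_an(W₂) = 0`, `p ∤ #Ш(W₂)` have `v_p(q) ≠ 0` for every rational `q` with
`L^*(W₂,1)/Ω(W₂) = q`, then `TrivialTwinSupplyX9` is FALSE (the one-step escape is closed by
`analyticRank_twin_ne_zero_of_even`). A typed refuter target; nothing is refuted here.
[cite: Darmon2004, §3.6 Thm. 3.15 and p. 39] [cite: BurungaleCastellaSkinner2025, §1.2, Prop. 5.2.1] -/
theorem not_trivialTwinSupplyX9_of_evenPair (hmod : exists_isNewformOf)
    (W : WeierstrassCurve ℚ) [W.IsElliptic] [W.IsGloballyMinimal] (p : ℕ) [Fact p.Prime]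
    (hX9 : ClassX9 W p) (hTam : ¬ p ∣ W.tamagawaProduct) (heven : Even W.analyticRank)
    (hno : ∀ dK dF : ℤ, BCSAdmissiblePair W p dK dF →
      ∀ (W₁ : WeierstrassCurve ℚ) (_ : W₁.IsElliptic) (_ : W₁.IsGloballyMinimal)
        (C : WeierstrassCurve.VariableChange ℚ), C • W₁ = W.quadraticTwist (dK : ℚ) →
        ∀ dK' dF' : ℤ, BCSAdmissiblePair W₁ p dK' dF' →
          ∀ (W₂ : WeierstrassCurve ℚ) (_ : W₂.IsElliptic) (_ : W₂.IsGloballyMinimal)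
            (C' : WeierstrassCurve.VariableChange ℚ), C' • W₂ = W₁.quadraticTwist (dK' : ℚ) →
            W₂.analyticRank = 0 → ¬ p ∣ W₂.shaOrder →
            ∀ q : ℚ, W₂.leadingLCoeff / (W₂.realPeriodRat : ℂ) = (q : ℂ) → padicValRat p q ≠ 0) :
    ¬ TrivialTwinSupplyX9 := by
  intro h
  obtain ⟨dK, dF, hadm, W₁, i₁, i₁', ⟨C, hC⟩, dK', dF', hadm', W₂, i₂, i₂', ⟨C', hC'⟩, hr, hsha, -, -, q, hq, hv⟩ :=
    (trivialTwinSupplyX9_parityCases hmod h W p hX9 hTam).2 heven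
  exact hno dK dF hadm W₁ i₁ i₁' C hC dK' dF' hadm' W₂ i₂ i₂' C' hC' hr hsha q hq hv

end Summit.BirchSwinnertonDyer.BirchSwinnertonDyer.Theorems.TwinTransportX9Rung
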